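import Summits.CriticalPhenomena.Ising3D.TaylorRegionCheckHybridL
import Mathlib.Tactic.Linarith
import Mathlib.Tactic.Positivity
import Mathlib.Tactic.Ring
import HarnessLib

/-!
# Per-`j` rows from the `(P, D)` table and their kernel-cheap sign tests (kernel-cost repair, part 1: machinery)
(cell `pub-ising3x`, seat recog-1 gen 11; gate (g2) — used by `TaylorRegionCheckHybridP` for checks with the statements of `TaylorRegionCheckHybrid(L)`)

HONEST FRAMING: lottery ticket; floor = tightest certified 3D Ising CFT bounds; no exact-solution
claim without a proof. Island framing: certified exclusion region at stated derivative order and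
assumptions; not a determination of the 3D Ising critical exponents beyond that.

MEASURED kernel cost of the hybrid rows `qRowI … j` (the `q`-sum list algorithm, `O(j·|l|·Λ²)` interval
products per row): on a real `Λ = 11` functional the row `j = 0` costs ≈ 20 s of `decide +kernel` at scale
`2^64` (posOn included) but the row `j = 41` did not finish building within the farm's 1 292 s — rows for all
`j ≤ J₁` are unaffordable that way. REPAIR: by `qSum_eq_sum_rows` (TaylorRegionCheckEJ) every row is a short linear
combination of the EVEN-`D` rows of the `(P, D)` table `kernelPDL` (built once per component), with the exact rational
moments `hMoment k j` as coefficients: `qRowOfTableI QI N j = Σ_{k<N} hMomentQ k j • QI[2k]` — `O(N·Λ)` interval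
operations per row (`TaylorRegionCheckHybridP` builds the checks on it). Sign tests in the variable `P = E − cc`
on `[max(E₀,j) − cc, E₁ − cc]`: `rowPosP` (one row), `rowPosDP` (discriminant, local products — sharp but ≈ 70 s
per piece in the kernel on a real table, MEASURED) and `rowPosDE` (discriminant from three `enclI` enclosures per
piece — product-free, kernel-cheap, slightly weaker). Elementary. [folklore]
-/

namespace Summit.CriticalPhenomena.Ising3D

open Finset Set
open Literature.Analysis.ValidatedNumerics Literature.Analysis.ValidatedNumerics.PolyMP
open Literature.Analysis.ValidatedNumerics.NumericsMP (MI)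
open Literature.MathematicalPhysics.QuantumFieldTheory.ConformalBootstrap3D

/-! ### Exact rational moments -/

/-- Horner evaluation over `ℚ`. [folklore] -/
def evalQL : List ℚ → ℚ → ℚ
  | [], _ => 0
  | a :: as, x => a + x * evalQL as x

/-- [folklore] -/
theorem cast_evalQL (x : ℚ) : ∀ l : List ℚ, ((evalQL l x : ℚ) : ℝ) = evalR (l.map ((↑) : ℚ → ℝ)) (x : ℝ)
  | [] => by simp [evalQL]
  | a :: l => by
      rw [evalQL, List.map_cons, evalR_cons, ← cast_evalQL x l]
      push_cast; ring

/-- `hMoment k j` as an exact rational (its polynomial form `hMomentListQ k` evaluated at `j`). [folklore] -/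
def hMomentQ (k j : ℕ) : ℚ := evalQL (hMomentListQ k) j

/-- [folklore] -/
theorem cast_hMomentQ (k j : ℕ) : ((hMomentQ k j : ℚ) : ℝ) = hMoment k j := by
  rw [hMomentQ, cast_evalQL, Rat.cast_natCast, evalR_hMomentListQ]

/-! ### Rows from a `(P, D)` table -/

/-- The row at integer `j` of a `(P, D)` interval table: `Σ_{k<N} hMoment(k,j) • QI[2k]`, a polynomial in `P`. [folklore] -/
def qRowOfTableI (QI : IPoly2) (N j : ℕ) : IPoly :=
  sumI (fun k => smulQI (hMomentQ k j) (QI.getD (2 * k) [])) N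

/-- Its real shadow. [folklore] -/
noncomputable def qRowOfTable (Q : List (List ℝ)) (N j : ℕ) : List ℝ :=
  sumR (fun k => smulR (hMoment k j) (Q.getD (2 * k) [])) N

/-- [folklore] -/
theorem pmem_qRowOfTableI {S : ℕ} {Q : List (List ℝ)} {QI : IPoly2} (hQ : PMem2 S Q QI) (N j : ℕ) :
    PMem S (qRowOfTable Q N j) (qRowOfTableI QI N j) :=
  pmem_sumI N fun k _ => pmem_smulQI (hMomentQ k j) (cast_hMomentQ k j) (pmem_getD_of_pmem2 hQ (2 * k))

/-- [folklore] -/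
theorem evalR_qRowOfTable (Q : List (List ℝ)) (N j : ℕ) (P : ℝ) :
    evalR (qRowOfTable Q N j) P = ∑ k ∈ range N, evalR (Q.getD (2 * k) []) P * hMoment k j := by
  rw [qRowOfTable, evalR_sumR]
  exact Finset.sum_congr rfl fun k _ => by rw [evalR_smulR, mul_comm]

/-- **The q-sum at integer `j` is the table row evaluated at `P = E − cc`.** [folklore] -/
theorem qSum_eq_evalR_qRowOfTable {S : ℕ} (hS : 0 < S) (cQ : ℕ × ℕ → ℚ) (σQ : ℚ) {s : ℝ} {sI : MI}
    (hs : MI.mem S s sI) (ccQ : ℚ) {l : List (ℕ × ℕ)} (hl : l.Nodup) {N : ℕ}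
    (hN : kernelSizeOK S cQ σQ sI ccQ l N = true) (E : ℝ) (j : ℕ) :
    qSum (fun ab => (cQ ab : ℝ)) l.toFinset s (σQ : ℝ) E j =
      evalR (qRowOfTable (kernelPDL (fun ab => (cQ ab : ℝ)) l s (σQ : ℝ) (ccQ : ℝ)) N j) (E - ccQ) := by
  rw [qSum_eq_sum_rows _ hl s _ _ (size2_le_of_kernelSizeOK hS hs hN) E j, evalR_qRowOfTable]

/-! ### Row tests in the variable `P = E − cc` -/

/-- `posOn` on `[max(E₀, j) − cc, E₁ − cc]`, skipped when empty. [folklore] -/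
def rowPosP (S dP : ℕ) (P : IPoly) (E0 E1 cc : ℚ) (j : ℕ) : Bool :=
  decide (E1 < max E0 (j : ℚ)) || posOn S dP P (max E0 (j : ℚ) - cc) (E1 - cc)

/-- [folklore] -/
theorem pos_of_rowPosP {S : ℕ} (hS : 0 < S) {dP : ℕ} {P : IPoly} {E0 E1 cc : ℚ} {j : ℕ}
    (h : rowPosP S dP P E0 E1 cc j = true) {as : List ℝ} (has : PMem S as P) {E : ℝ} (hE0 : (E0 : ℝ) ≤ E)
    (hjE : (j : ℝ) ≤ E) (hE1 : E ≤ E1) : 0 < evalR as (E - cc) := by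
  simp only [rowPosP, Bool.or_eq_true, decide_eq_true_eq] at h
  have hlo : ((max E0 (j : ℚ) : ℚ) : ℝ) ≤ E := by push_cast; exact max_le hE0 hjE
  rcases h with hvac | hpos
  · exfalso
    have : ((E1 : ℚ) : ℝ) < ((max E0 (j : ℚ) : ℚ) : ℝ) := by exact_mod_cast hvac
    linarith
  · have hle : max E0 (j : ℚ) - cc ≤ E1 - cc := by
      have : ((max E0 (j : ℚ) : ℚ) : ℝ) ≤ (E1 : ℝ) := hlo.trans hE1
      have : max E0 (j : ℚ) ≤ E1 := by exact_mod_cast this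
      linarith
    have h' := hlo
    push_cast at h'
    exact posOn_sound hS hpos hle has (by push_cast; linarith) (by push_cast; linarith)

/-- Local discriminant test on `[max(E₀, j) − cc, E₁ − cc]`, skipped when empty. [folklore] -/
def rowPosDP (S dP : ℕ) (RX RY RZ : IPoly) (E0 E1 cc : ℚ) (j : ℕ) : Bool :=
  decide (E1 < max E0 (j : ℚ)) || posOnD S RX RY RZ dP (max E0 (j : ℚ) - cc) (E1 - cc)

/-- [folklore] -/
theorem disc_of_rowPosDP {S : ℕ} (hS : 0 < S) {dP : ℕ} {RX RY RZ : IPoly} {E0 E1 cc : ℚ} {j : ℕ}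
    (h : rowPosDP S dP RX RY RZ E0 E1 cc j = true) {ax ay az : List ℝ} (hx : PMem S ax RX) (hy : PMem S ay RY)
    (hz : PMem S az RZ) {E : ℝ} (hE0 : (E0 : ℝ) ≤ E) (hjE : (j : ℝ) ≤ E) (hE1 : E ≤ E1) :
    evalR az (E - cc) * evalR az (E - cc) < 4 * (evalR ax (E - cc) * evalR ay (E - cc)) := by
  simp only [rowPosDP, Bool.or_eq_true, decide_eq_true_eq] at h
  have hlo : ((max E0 (j : ℚ) : ℚ) : ℝ) ≤ E := by push_cast; exact max_le hE0 hjE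
  rcases h with hvac | hpos
  · exfalso
    have : ((E1 : ℚ) : ℝ) < ((max E0 (j : ℚ) : ℚ) : ℝ) := by exact_mod_cast hvac
    linarith
  · have hle : max E0 (j : ℚ) - cc ≤ E1 - cc := by
      have : ((max E0 (j : ℚ) : ℚ) : ℝ) ≤ (E1 : ℝ) := hlo.trans hE1
      have : max E0 (j : ℚ) ≤ E1 := by exact_mod_cast this
      linarith
    have h' := hlo
    push_cast at h'
    exact posOnD_sound hS hx hy hz hpos hle (by push_cast; linarith) (by push_cast; linarith)

/-! ### Discriminant from three enclosures (no polynomial products: kernel-cheap) -/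

/-- One piece `[lo, hi]`: enclose the three rows on the piece (`enclI`) and test `X, Y > 0`, `|Z|² < 4·X·Y` on the
enclosures (scaled integers). Loses the correlation inside the piece, gains a product-free kernel evaluation. [folklore] -/
def posCoreDE (S : ℕ) (RX RY RZ : IPoly) (lo hi : ℚ) : Bool :=
  let ex := enclI S RX ((lo + hi) / 2) ((hi - lo) / 2)
  let ey := enclI S RY ((lo + hi) / 2) ((hi - lo) / 2)
  let ez := enclI S RZ ((lo + hi) / 2) ((hi - lo) / 2)
  decide (0 < ex.lo) && decide (0 < ey.lo) && decide (ez.absHi * ez.absHi < 4 * (ex.lo * ey.lo))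

/-- [folklore] -/
theorem posCoreDE_sound {S : ℕ} (hS : 0 < S) {RX RY RZ : IPoly} {lo hi : ℚ}
    (h : posCoreDE S RX RY RZ lo hi = true) (hle : lo ≤ hi) {ax ay az : List ℝ} (hx : PMem S ax RX)
    (hy : PMem S ay RY) (hz : PMem S az RZ) {x : ℝ} (hlo : (lo : ℝ) ≤ x) (hhi : x ≤ hi) :
    evalR az x * evalR az x < 4 * (evalR ax x * evalR ay x) := by
  simp only [posCoreDE, Bool.and_eq_true, decide_eq_true_eq] at h
  obtain ⟨⟨h1, h2⟩, h3⟩ := h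
  have hw0 : (0 : ℚ) ≤ (hi - lo) / 2 := by linarith
  have hc : |x - (((lo + hi) / 2 : ℚ) : ℝ)| ≤ (((hi - lo) / 2 : ℚ) : ℝ) := by
    push_cast; rw [abs_le]; constructor <;> linarith
  have mx := mem_enclI hS hx hw0 hc
  have my := mem_enclI hS hy hw0 hc
  have mz := mem_enclI hS hz hw0 hc
  have aZ := MI.abs_le_absHi mz
  set X := evalR ax x
  set Y := evalR ay x
  set Z := evalR az x
  have hSpos : (0 : ℝ) < S := by exact_mod_cast hS
  have h1R : (0 : ℝ) < (enclI S RX ((lo + hi) / 2) ((hi - lo) / 2)).lo := by exact_mod_cast h1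
  have h2R : (0 : ℝ) < (enclI S RY ((lo + hi) / 2) ((hi - lo) / 2)).lo := by exact_mod_cast h2
  have h3R : ((enclI S RZ ((lo + hi) / 2) ((hi - lo) / 2)).absHi : ℝ) *
      (enclI S RZ ((lo + hi) / 2) ((hi - lo) / 2)).absHi <
      4 * (((enclI S RX ((lo + hi) / 2) ((hi - lo) / 2)).lo : ℝ) * (enclI S RY ((lo + hi) / 2) ((hi - lo) / 2)).lo) := by
    exact_mod_cast h3
  have hXlo := mx.1
  have hYlo := my.1
  have hXS : 0 ≤ X * S := h1R.le.trans hXlo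
  have hZ2 : (Z * S) * (Z * S) ≤ ((enclI S RZ ((lo + hi) / 2) ((hi - lo) / 2)).absHi : ℝ) *
      (enclI S RZ ((lo + hi) / 2) ((hi - lo) / 2)).absHi := by
    have h0 : 0 ≤ |Z| * S := by positivity
    have e : (Z * S) * (Z * S) = (|Z| * S) * (|Z| * S) := by
      rw [show (Z * S) * (Z * S) = (Z * Z) * (S * S) by ring, ← abs_mul_abs_self Z]; ring
    rw [e]
    exact mul_le_mul aZ aZ h0 (h0.trans aZ)
  have hXY : ((enclI S RX ((lo + hi) / 2) ((hi - lo) / 2)).lo : ℝ) *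
      (enclI S RY ((lo + hi) / 2) ((hi - lo) / 2)).lo ≤ (X * S) * (Y * S) :=
    mul_le_mul hXlo hYlo h2R.le hXS
  have key : (Z * S) * (Z * S) < 4 * ((X * S) * (Y * S)) := by linarith
  have hS2 : (0 : ℝ) < (S : ℝ) * S := by positivity
  nlinarith [key, hS2]

/-- Bisection to depth `d`. [folklore] -/
def posOnDE (S : ℕ) (RX RY RZ : IPoly) : ℕ → ℚ → ℚ → Bool
  | 0, a, b => posCoreDE S RX RY RZ a b
  | d + 1, a, b =>
      posCoreDE S RX RY RZ a b ||
        (posOnDE S RX RY RZ d a ((a + b) / 2) && posOnDE S RX RY RZ d ((a + b) / 2) b)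

/-- [folklore] -/
theorem posOnDE_sound {S : ℕ} (hS : 0 < S) {RX RY RZ : IPoly} {ax ay az : List ℝ} (hx : PMem S ax RX)
    (hy : PMem S ay RY) (hz : PMem S az RZ) : ∀ {d : ℕ} {lo hi : ℚ},
    posOnDE S RX RY RZ d lo hi = true → lo ≤ hi →
      ∀ {x : ℝ}, (lo : ℝ) ≤ x → x ≤ hi → evalR az x * evalR az x < 4 * (evalR ax x * evalR ay x)
  | 0, _, _, h, hle, _, hlo, hhi => posCoreDE_sound hS h hle hx hy hz hlo hhi
  | d + 1, a, b, h, hle, x, hlo, hhi => by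
      simp only [posOnDE, Bool.or_eq_true, Bool.and_eq_true] at h
      rcases h with h | ⟨h1, h2⟩
      · exact posCoreDE_sound hS h hle hx hy hz hlo hhi
      · have hm1 : a ≤ (a + b) / 2 := by linarith
        have hm2 : (a + b) / 2 ≤ b := by linarith
        have hmR : (((a + b) / 2 : ℚ) : ℝ) = ((a : ℝ) + b) / 2 := by push_cast; ring
        rcases le_or_gt x (((a : ℝ) + b) / 2) with hxm | hxm
        · exact posOnDE_sound hS hx hy hz h1 hm1 hlo (by rw [hmR]; exact hxm)
        · exact posOnDE_sound hS hx hy hz h2 hm2 (by rw [hmR]; exact hxm.le) hhi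

/-- Enclosure discriminant test on `[max(E₀, j) − cc, E₁ − cc]`, skipped when empty. [folklore] -/
def rowPosDE (S dP : ℕ) (RX RY RZ : IPoly) (E0 E1 cc : ℚ) (j : ℕ) : Bool :=
  decide (E1 < max E0 (j : ℚ)) || posOnDE S RX RY RZ dP (max E0 (j : ℚ) - cc) (E1 - cc)

/-- [folklore] -/
theorem disc_of_rowPosDE {S : ℕ} (hS : 0 < S) {dP : ℕ} {RX RY RZ : IPoly} {E0 E1 cc : ℚ} {j : ℕ}
    (h : rowPosDE S dP RX RY RZ E0 E1 cc j = true) {ax ay az : List ℝ} (hx : PMem S ax RX) (hy : PMem S ay RY)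
    (hz : PMem S az RZ) {E : ℝ} (hE0 : (E0 : ℝ) ≤ E) (hjE : (j : ℝ) ≤ E) (hE1 : E ≤ E1) :
    evalR az (E - cc) * evalR az (E - cc) < 4 * (evalR ax (E - cc) * evalR ay (E - cc)) := by
  simp only [rowPosDE, Bool.or_eq_true, decide_eq_true_eq] at h
  have hlo : ((max E0 (j : ℚ) : ℚ) : ℝ) ≤ E := by push_cast; exact max_le hE0 hjE
  rcases h with hvac | hpos
  · exfalso
    have : ((E1 : ℚ) : ℝ) < ((max E0 (j : ℚ) : ℚ) : ℝ) := by exact_mod_cast hvac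
    linarith
  · have hle : max E0 (j : ℚ) - cc ≤ E1 - cc := by
      have : ((max E0 (j : ℚ) : ℚ) : ℝ) ≤ (E1 : ℝ) := hlo.trans hE1
      have : max E0 (j : ℚ) ≤ E1 := by exact_mod_cast this
      linarith
    have h' := hlo
    push_cast at h'
    exact posOnDE_sound hS hx hy hz hpos hle (by push_cast; linarith) (by push_cast; linarith)

end Summit.CriticalPhenomena.Ising3D
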